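import Summits.AtomisticToContinuum.HydrodynamicLimit.Theorems.CollisionIsometryCLTAdaptedWeightCLTBHEEPClosureCloud
import Summits.AtomisticToContinuum.HydrodynamicLimit.Theorems.CollisionIsometryCLTAdaptedWeightCLTTLReductionDictionary
import Summits.AtomisticToContinuum.HydrodynamicLimit.Theorems.CollisionIsometryCLTAdaptedWeightCLTTLReductionBounds
import Mathlib.Analysis.MeanInequalitiesPow

/-!
# Stub `stub_eepClosure` (S5) of the line `block-h-dissipation-closure`, helper file 3: the DICTIONARY between the
cell objects of the vocabulary, the crux integrand, and velocity clouds
(crux `CollisionIsometryCLT.AdaptedWeightCLT`, stmt-AtomisticToContinuum-14868; `--supports`)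

Step (v), algebraic half, of the planner's sketch of `stub_eepClosure` (pure finite-sum algebra, every
configuration, no measure theory). A cell of the vocabulary (kernel family `ψ`, configuration `w`, location `x`)
IS the velocity cloud with probability weights `p_i = ψ_N(x_i − x)/W_x` (`cellProb`) and velocities `v_i`:
* `cU = cloudMean`, `cT = cloudTemp`, `kde = cloudKde`, `cellLaw = cloudLaw` (`cU_eq_cloudMean`, `cT_eq_cloudTemp`,
  `cellLaw_eq_cloudLaw`; unconditionally, the junk conventions `0⁻¹ = 0` agreeing on empty cells);
* along a flow, the block weights and block velocity of the crux (`wgt`, `ubar` of `…Theorems.ContactSourceDuhamel`)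
  are the cell weights and cell velocity (`wgt_eq_cw`, `ubar_eq_cU`), the flow-side block moments are the cloud's
  traceless second / half-third central moments times the block density `ρ̄ = W_x/(N+1)`
  (`blkFlow_C2_eq`, `blkFlow_C3_eq`), and so THE CRUX INTEGRAND `Σ_{jk} D² + |q|² = DefectSq` (landed
  `Reduction.cruxIntegrand_eq`) IS `ρ̄² · cloudDefect` (`defectSq_eq`), `cloudDefect = Σ_{jk} cloudP2² + Σ_a cloudP3²`;
* the uniform-integrability ENVELOPE `cloudDefect ≤ 1024 Σ_i p_i (1 + |v_i|⁶)` (`cloudDefect_le`; power means: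
  the centring by `ū` costs at most a factor `2^{m+1}` on `m`-th moments).
Registered anchor: `bhEEPClosure_dictionary_anchor` (`cellLaw = cloudLaw`, `∀`-closed, defs unfolded).
-/

namespace Summit.AtomisticToContinuum.HydrodynamicLimit.Theorems.BlockHDissipation

open scoped BigOperators Topology Classical MeasureTheory ENNReal InnerProductSpace
open Filter Set MeasureTheory
open Literature.Analysis.FluidPDE
open Summit.AtomisticToContinuum.HydrodynamicLimit.Theorems.ContactSourceDuhamel (T3 V3 Cfg Vel Flow Flows wgt ubar blkFlow
  DefectSq C2 C3 pairT tpow)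
open Summit.AtomisticToContinuum.HydrodynamicLimit.Theorems.ContactSourceDuhamel.TimeLocal.Reduction (pairT_C2_tpow
  pairT_C3_tpow ubar_eq')

noncomputable section

namespace EEP

variable {N : ℕ}

/-! ## A cell is a velocity cloud -/

/-- The probability weights of the cell at `x`: `p_i = ψ_N(x_i − x) / W_x` (junk `0` on an empty cell). -/
def cellProb (N : ℕ) (ψ : ℕ → T3 → ℝ) (w : Cfg N) (x : T3) (i : Fin (N + 1)) : ℝ := cw N ψ w x i / cW N ψ w x

/-- The velocities of the configuration. -/
def cellVel (w : Cfg N) (i : Fin (N + 1)) : V3 := (w i).2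

/-- The cloud defect: `Σ_{jk} cloudP2² + Σ_a cloudP3²` (squared traceless stress plus squared heat flux of the
atomic cloud, both centred at the cloud mean). -/
def cloudDefect {n : ℕ} (p : Fin n → ℝ) (v : Fin n → V3) : ℝ :=
  (∑ j : Fin 3, ∑ k : Fin 3, cloudP2 p v j k ^ 2) + ∑ a : Fin 3, cloudP3 p v a ^ 2

section Cell

variable (ψ : ℕ → T3 → ℝ) (w : Cfg N) (x : T3)

/-- The cell weights of a nonnegative kernel are nonnegative. -/
theorem cellProb_nonneg (hψ : ∀ N y, 0 ≤ ψ N y) (i : Fin (N + 1)) : 0 ≤ cellProb N ψ w x i :=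
  div_nonneg (hψ N _) (Finset.sum_nonneg fun _ _ => hψ N _)

/-- On a nonempty cell the weights sum to one. -/
theorem sum_cellProb (hW : cW N ψ w x ≠ 0) : ∑ i, cellProb N ψ w x i = 1 := by
  unfold cellProb
  rw [← Finset.sum_div, show ∑ i, cw N ψ w x i = cW N ψ w x from rfl, div_self hW]

/-- Weighted cell sums are `W_x` times cloud averages: `Σ_i ψ_i F_i = W_x Σ_i p_i F_i` (nonnegative kernel). -/
theorem sum_cw_mul_eq (hψ : ∀ N y, 0 ≤ ψ N y) (F : Fin (N + 1) → ℝ) :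
    ∑ i, cw N ψ w x i * F i = cW N ψ w x * ∑ i, cellProb N ψ w x i * F i := by
  by_cases hW : cW N ψ w x = 0
  · have h0 : ∀ i, cw N ψ w x i = 0 := fun i =>
      (Finset.sum_eq_zero_iff_of_nonneg fun j _ => hψ N ((w j).1 - x)).1 hW i (Finset.mem_univ i)
    simp [h0, hW]
  · rw [Finset.mul_sum]
    refine Finset.sum_congr rfl fun i _ => ?_
    unfold cellProb
    field_simp

/-- `cU = cloudMean` (unconditionally). -/
theorem cU_eq_cloudMean : cU N ψ w x = cloudMean (cellProb N ψ w x) (cellVel w) := by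
  unfold cU cloudMean cellProb cellVel
  rw [Finset.smul_sum]
  refine Finset.sum_congr rfl fun i _ => ?_
  rw [smul_smul, div_eq_inv_mul]

/-- `cT = cloudTemp` (unconditionally). -/
theorem cT_eq_cloudTemp : cT N ψ w x = cloudTemp (cellProb N ψ w x) (cellVel w) := by
  unfold cT cloudTemp
  rw [← cU_eq_cloudMean, Finset.mul_sum, Finset.sum_div]
  refine Finset.sum_congr rfl fun i _ => ?_
  unfold cellProb cellVel
  ring

/-- `kde = cloudKde` (unconditionally). -/
theorem kde_eq_cloudKde (h : ℝ) (v : V3) : kde N ψ h w x v = cloudKde h (cellProb N ψ w x) (cellVel w) v := by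
  unfold kde cloudKde cellProb cellVel
  rw [Finset.mul_sum]
  refine Finset.sum_congr rfl fun i _ => ?_
  ring

/-- **`cellLaw = cloudLaw`**: the regularised cell law of the vocabulary is the regularised law of the cell's
velocity cloud (unconditionally). -/
theorem cellLaw_eq_cloudLaw (h δ : ℝ) : cellLaw N ψ h δ w x = cloudLaw h δ (cellProb N ψ w x) (cellVel w) := by
  funext v
  unfold cellLaw cloudLaw cloudMaxw
  rw [kde_eq_cloudKde, cT_eq_cloudTemp, cU_eq_cloudMean]

end Cell

/-! ## The crux integrand along a flow -/

section FlowSide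

variable {σ : ℝ} (Φ : Flow σ N) (ψ : ℕ → T3 → ℝ) (s : ℝ) (z : Cfg N) (x : T3)

/-- The block weights are the cell weights of the current configuration (definitional). -/
theorem wgt_eq_cw (i : Fin (N + 1)) : wgt σ N Φ ψ s z x i = cw N ψ (Φ.flow s z) x i := rfl

/-- The block velocity of the crux is the cell velocity: `ubar = cU` (unconditionally: `(a W)⁻¹ (a S) = W⁻¹ S`). -/
theorem ubar_eq_cU : ubar σ N Φ ψ s z x = cU N ψ (Φ.flow s z) x := by
  rw [ubar_eq', smul_smul]
  unfold cU
  set A : ℝ := (((N + 1 : ℕ) : ℝ))⁻¹ with hA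
  have hA0 : A ≠ 0 := inv_ne_zero (by positivity)
  congr 1
  show (A * cW N ψ (Φ.flow s z) x)⁻¹ * A = (cW N ψ (Φ.flow s z) x)⁻¹
  rw [mul_inv, mul_assoc, mul_comm (cW N ψ (Φ.flow s z) x)⁻¹ A, ← mul_assoc, inv_mul_cancel₀ hA0, one_mul]

/-- STRESS CHANNEL: `blkFlow 2 (C2 j k) = ρ̄ · cloudP2` with `ρ̄ = W_x/(N+1)` (nonnegative kernel). -/
theorem blkFlow_C2_eq (hψ : ∀ N y, 0 ≤ ψ N y) (j k : Fin 3) :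
    blkFlow 2 σ N Φ ψ s z x (C2 j k) =
      ((N + 1 : ℕ) : ℝ)⁻¹ * cW N ψ (Φ.flow s z) x * cloudP2 (cellProb N ψ (Φ.flow s z) x) (cellVel (Φ.flow s z)) j k := by
  unfold blkFlow cloudP2
  simp only [wgt_eq_cw, ubar_eq_cU, pairT_C2_tpow, mul_assoc]
  rw [sum_cw_mul_eq ψ (Φ.flow s z) x hψ]
  congr 1
  congr 1
  refine Finset.sum_congr rfl fun i _ => ?_
  congr 1
  rw [cU_eq_cloudMean]
  simp only [p2Poly, cellVel, PiLp.sub_apply, EuclideanSpace.real_norm_sq_eq]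

/-- HEAT-FLUX CHANNEL: `blkFlow 3 (C3 a) = ρ̄ · cloudP3` (nonnegative kernel). -/
theorem blkFlow_C3_eq (hψ : ∀ N y, 0 ≤ ψ N y) (a : Fin 3) :
    blkFlow 3 σ N Φ ψ s z x (C3 a) =
      ((N + 1 : ℕ) : ℝ)⁻¹ * cW N ψ (Φ.flow s z) x * cloudP3 (cellProb N ψ (Φ.flow s z) x) (cellVel (Φ.flow s z)) a := by
  unfold blkFlow cloudP3
  simp only [wgt_eq_cw, ubar_eq_cU, pairT_C3_tpow, mul_assoc]
  rw [sum_cw_mul_eq ψ (Φ.flow s z) x hψ]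
  congr 1
  congr 1
  refine Finset.sum_congr rfl fun i _ => ?_
  congr 1
  rw [cU_eq_cloudMean]
  simp only [p3Poly, cellVel, PiLp.sub_apply, EuclideanSpace.real_norm_sq_eq]

/-- **THE CRUX INTEGRAND IS `ρ̄² · cloudDefect`**: `DefectSq = ((N+1)⁻¹ W_x)² · cloudDefect` (nonnegative kernel). -/
theorem defectSq_eq (hψ : ∀ N y, 0 ≤ ψ N y) :
    DefectSq σ N Φ ψ s z x =
      (((N + 1 : ℕ) : ℝ)⁻¹ * cW N ψ (Φ.flow s z) x) ^ 2 *
        cloudDefect (cellProb N ψ (Φ.flow s z) x) (cellVel (Φ.flow s z)) := by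
  unfold DefectSq cloudDefect
  simp only [blkFlow_C2_eq Φ ψ s z x hψ, blkFlow_C3_eq Φ ψ s z x hψ, mul_pow, Finset.mul_sum, mul_add]

end FlowSide

/-! ## The uniform-integrability envelope of the cloud defect -/

section Envelope

variable {n : ℕ} {p : Fin n → ℝ} {v : Fin n → V3}

/-- Power means: `(Σ p_i a_i)^m ≤ Σ p_i a_i^m` for probability weights and `a ≥ 0`. -/
theorem pow_sum_le (hp : ∀ i, 0 ≤ p i) (hp1 : ∑ i, p i = 1) {a : Fin n → ℝ} (ha : ∀ i, 0 ≤ a i) (m : ℕ) :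
    (∑ i, p i * a i) ^ m ≤ ∑ i, p i * a i ^ m :=
  Real.pow_arith_mean_le_arith_mean_pow Finset.univ p a (fun i _ => hp i) hp1 (fun i _ => ha i) m

/-- The mean is dominated in every power: `|ū|^m ≤ Σ p_i |v_i|^m`. -/
theorem norm_cloudMean_pow_le (hp : ∀ i, 0 ≤ p i) (hp1 : ∑ i, p i = 1) (m : ℕ) :
    ‖cloudMean p v‖ ^ m ≤ ∑ i, p i * ‖v i‖ ^ m := by
  have h1 : ‖cloudMean p v‖ ≤ ∑ i, p i * ‖v i‖ := by
    unfold cloudMean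
    refine (norm_sum_le _ _).trans (le_of_eq (Finset.sum_congr rfl fun i _ => ?_))
    rw [norm_smul, Real.norm_eq_abs, abs_of_nonneg (hp i)]
  exact (pow_le_pow_left₀ (norm_nonneg _) h1 m).trans (pow_sum_le hp hp1 (fun i => norm_nonneg _) m)

/-- CENTRING COSTS A FACTOR `2^{m+1}`: `Σ p_i |v_i − ū|^m ≤ 2^{m+1} Σ p_i |v_i|^m`. -/
theorem sum_norm_sub_mean_pow_le (hp : ∀ i, 0 ≤ p i) (hp1 : ∑ i, p i = 1) (m : ℕ) :
    ∑ i, p i * ‖v i - cloudMean p v‖ ^ m ≤ 2 ^ (m + 1) * ∑ i, p i * ‖v i‖ ^ m := by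
  -- `(a + b)^m ≤ 2^m (a^m + b^m)` for `a, b ≥ 0` (through `2 max(a, b)`)
  have hadd : ∀ {a b : ℝ}, 0 ≤ a → 0 ≤ b → (a + b) ^ m ≤ 2 ^ m * (a ^ m + b ^ m) := by
    intro a b ha hb
    have h1 : a + b ≤ 2 * max a b := by
      rcases le_total a b with h | h
      · rw [max_eq_right h]; linarith
      · rw [max_eq_left h]; linarith
    have h2 : (max a b) ^ m ≤ a ^ m + b ^ m := by
      rcases le_total a b with h | h
      · rw [max_eq_right h]; linarith [pow_nonneg ha m]
      · rw [max_eq_left h]; linarith [pow_nonneg hb m]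
    calc (a + b) ^ m ≤ (2 * max a b) ^ m := pow_le_pow_left₀ (add_nonneg ha hb) h1 m
      _ = 2 ^ m * (max a b) ^ m := mul_pow _ _ _
      _ ≤ 2 ^ m * (a ^ m + b ^ m) := mul_le_mul_of_nonneg_left h2 (by positivity)
  have hpt : ∀ i, ‖v i - cloudMean p v‖ ^ m ≤ 2 ^ m * (‖v i‖ ^ m + ‖cloudMean p v‖ ^ m) := fun i =>
    (pow_le_pow_left₀ (norm_nonneg _) (norm_sub_le _ _) m).trans (hadd (norm_nonneg _) (norm_nonneg _))
  calc ∑ i, p i * ‖v i - cloudMean p v‖ ^ m ≤ ∑ i, p i * (2 ^ m * (‖v i‖ ^ m + ‖cloudMean p v‖ ^ m)) :=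
        Finset.sum_le_sum fun i _ => mul_le_mul_of_nonneg_left (hpt i) (hp i)
    _ = 2 ^ m * (∑ i, p i * ‖v i‖ ^ m + ‖cloudMean p v‖ ^ m) := by
        simp only [mul_add, Finset.sum_add_distrib, ← Finset.sum_mul, hp1, one_mul, Finset.mul_sum]
        congr 1
        exact Finset.sum_congr rfl fun i _ => by ring
    _ ≤ 2 ^ m * (∑ i, p i * ‖v i‖ ^ m + ∑ i, p i * ‖v i‖ ^ m) :=
        mul_le_mul_of_nonneg_left (add_le_add_right (norm_cloudMean_pow_le hp hp1 m) _) (by positivity)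
    _ = 2 ^ (m + 1) * ∑ i, p i * ‖v i‖ ^ m := by rw [pow_succ]; ring

/-- Pointwise size of the traceless quadratic test: `|p₂(y + u)| ≤ (4/3) |y|²`. -/
theorem abs_p2Poly_le_norm_sq (u y : V3) (j k : Fin 3) : |p2Poly u j k y| ≤ 4 / 3 * ‖y - u‖ ^ 2 := by
  have hco : ∀ l : Fin 3, |y l - u l| ≤ ‖y - u‖ := fun l => by
    have := (Real.norm_eq_abs _).symm.le.trans (PiLp.norm_apply_le (y - u) l)
    simpa only [PiLp.sub_apply] using this
  have h1 : |(y j - u j) * (y k - u k)| ≤ ‖y - u‖ ^ 2 := by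
    rw [abs_mul, sq]; exact mul_le_mul (hco j) (hco k) (abs_nonneg _) (norm_nonneg _)
  have h2 : |(if j = k then ‖y - u‖ ^ 2 / 3 else 0 : ℝ)| ≤ ‖y - u‖ ^ 2 / 3 := by
    split_ifs
    · rw [abs_of_nonneg (by positivity)]
    · rw [abs_zero]; positivity
  unfold p2Poly
  calc |(y j - u j) * (y k - u k) - (if j = k then ‖y - u‖ ^ 2 / 3 else 0)|
      ≤ ‖y - u‖ ^ 2 + ‖y - u‖ ^ 2 / 3 := (abs_sub _ _).trans (add_le_add h1 h2)
    _ = 4 / 3 * ‖y - u‖ ^ 2 := by ring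

/-- Pointwise size of the heat-flux test: `|p₃(y)| ≤ ½ |y − u|³`. -/
theorem abs_p3Poly_le_norm_cube (u y : V3) (a : Fin 3) : |p3Poly u a y| ≤ 1 / 2 * ‖y - u‖ ^ 3 := by
  have ha : |y a - u a| ≤ ‖y - u‖ := by
    have := (Real.norm_eq_abs _).symm.le.trans (PiLp.norm_apply_le (y - u) a)
    simpa only [PiLp.sub_apply] using this
  unfold p3Poly
  rw [abs_mul, abs_of_nonneg (by positivity)]
  calc ‖y - u‖ ^ 2 / 2 * |y a - u a| ≤ ‖y - u‖ ^ 2 / 2 * ‖y - u‖ := mul_le_mul_of_nonneg_left ha (by positivity)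
    _ = 1 / 2 * ‖y - u‖ ^ 3 := by ring

/-- Stress channel: `cloudP2² ≤ (512/9) Σ p_i |v_i|⁴`. -/
theorem cloudP2_sq_le (hp : ∀ i, 0 ≤ p i) (hp1 : ∑ i, p i = 1) (j k : Fin 3) :
    cloudP2 p v j k ^ 2 ≤ 512 / 9 * ∑ i, p i * ‖v i‖ ^ 4 := by
  set c2 : ℝ := ∑ i, p i * ‖v i - cloudMean p v‖ ^ 2 with hc2
  have habs : |cloudP2 p v j k| ≤ 4 / 3 * c2 := by
    unfold cloudP2
    refine (Finset.abs_sum_le_sum_abs _ _).trans ?_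
    rw [hc2, Finset.mul_sum]
    refine Finset.sum_le_sum fun i _ => ?_
    rw [abs_mul, abs_of_nonneg (hp i)]
    calc p i * |p2Poly (cloudMean p v) j k (v i)| ≤ p i * (4 / 3 * ‖v i - cloudMean p v‖ ^ 2) :=
          mul_le_mul_of_nonneg_left (abs_p2Poly_le_norm_sq _ _ j k) (hp i)
      _ = 4 / 3 * (p i * ‖v i - cloudMean p v‖ ^ 2) := by ring
  have hc2sq : c2 ^ 2 ≤ ∑ i, p i * ‖v i - cloudMean p v‖ ^ 4 := by
    have := pow_sum_le hp hp1 (a := fun i => ‖v i - cloudMean p v‖ ^ 2) (fun i => by positivity) 2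
    simpa only [← pow_mul] using this
  have h4 := sum_norm_sub_mean_pow_le (v := v) hp hp1 4
  have hsq : cloudP2 p v j k ^ 2 ≤ (4 / 3 * c2) ^ 2 := by
    rw [← sq_abs]; exact pow_le_pow_left₀ (abs_nonneg _) habs 2
  calc cloudP2 p v j k ^ 2 ≤ (4 / 3 * c2) ^ 2 := hsq
    _ = 16 / 9 * c2 ^ 2 := by ring
    _ ≤ 16 / 9 * (2 ^ (4 + 1) * ∑ i, p i * ‖v i‖ ^ 4) := mul_le_mul_of_nonneg_left (hc2sq.trans h4) (by norm_num)
    _ = 512 / 9 * ∑ i, p i * ‖v i‖ ^ 4 := by norm_num; ring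

/-- Heat-flux channel: `cloudP3² ≤ 32 Σ p_i |v_i|⁶`. -/
theorem cloudP3_sq_le (hp : ∀ i, 0 ≤ p i) (hp1 : ∑ i, p i = 1) (a : Fin 3) :
    cloudP3 p v a ^ 2 ≤ 32 * ∑ i, p i * ‖v i‖ ^ 6 := by
  set c3 : ℝ := ∑ i, p i * ‖v i - cloudMean p v‖ ^ 3 with hc3
  have habs : |cloudP3 p v a| ≤ 1 / 2 * c3 := by
    unfold cloudP3
    refine (Finset.abs_sum_le_sum_abs _ _).trans ?_
    rw [hc3, Finset.mul_sum]
    refine Finset.sum_le_sum fun i _ => ?_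
    rw [abs_mul, abs_of_nonneg (hp i)]
    calc p i * |p3Poly (cloudMean p v) a (v i)| ≤ p i * (1 / 2 * ‖v i - cloudMean p v‖ ^ 3) :=
          mul_le_mul_of_nonneg_left (abs_p3Poly_le_norm_cube _ _ a) (hp i)
      _ = 1 / 2 * (p i * ‖v i - cloudMean p v‖ ^ 3) := by ring
  have hc3sq : c3 ^ 2 ≤ ∑ i, p i * ‖v i - cloudMean p v‖ ^ 6 := by
    have := pow_sum_le hp hp1 (a := fun i => ‖v i - cloudMean p v‖ ^ 3) (fun i => by positivity) 2
    simpa only [← pow_mul] using this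
  have h6 := sum_norm_sub_mean_pow_le (v := v) hp hp1 6
  have hsq : cloudP3 p v a ^ 2 ≤ (1 / 2 * c3) ^ 2 := by
    rw [← sq_abs]; exact pow_le_pow_left₀ (abs_nonneg _) habs 2
  calc cloudP3 p v a ^ 2 ≤ (1 / 2 * c3) ^ 2 := hsq
    _ = 1 / 4 * c3 ^ 2 := by ring
    _ ≤ 1 / 4 * (2 ^ (6 + 1) * ∑ i, p i * ‖v i‖ ^ 6) := mul_le_mul_of_nonneg_left (hc3sq.trans h6) (by norm_num)
    _ = 32 * ∑ i, p i * ‖v i‖ ^ 6 := by norm_num; ring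

/-- **THE ENVELOPE**: `cloudDefect ≤ 1024 Σ_i p_i (1 + |v_i|⁶)` for a probability cloud. -/
theorem cloudDefect_le (hp : ∀ i, 0 ≤ p i) (hp1 : ∑ i, p i = 1) :
    cloudDefect p v ≤ 1024 * ∑ i, p i * (1 + ‖v i‖ ^ 6) := by
  have hm : ∀ i, ‖v i‖ ^ 4 ≤ 1 + ‖v i‖ ^ 6 := fun i => by
    rcases le_total ‖v i‖ 1 with h | h
    · have : ‖v i‖ ^ 4 ≤ 1 := pow_le_one₀ (norm_nonneg _) h
      linarith [pow_nonneg (norm_nonneg (v i)) 6]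
    · have : ‖v i‖ ^ 4 ≤ ‖v i‖ ^ 6 := pow_le_pow_right₀ h (by norm_num)
      linarith
  have h46 : ∑ i, p i * ‖v i‖ ^ 4 ≤ ∑ i, p i * (1 + ‖v i‖ ^ 6) :=
    Finset.sum_le_sum fun i _ => mul_le_mul_of_nonneg_left (hm i) (hp i)
  have h66 : ∑ i, p i * ‖v i‖ ^ 6 ≤ ∑ i, p i * (1 + ‖v i‖ ^ 6) :=
    Finset.sum_le_sum fun i _ => mul_le_mul_of_nonneg_left (by linarith) (hp i)
  have hS : 0 ≤ ∑ i, p i * (1 + ‖v i‖ ^ 6) := Finset.sum_nonneg fun i _ => mul_nonneg (hp i) (by positivity)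
  unfold cloudDefect
  calc (∑ j : Fin 3, ∑ k : Fin 3, cloudP2 p v j k ^ 2) + ∑ a : Fin 3, cloudP3 p v a ^ 2
      ≤ (∑ _j : Fin 3, ∑ _k : Fin 3, 512 / 9 * ∑ i, p i * ‖v i‖ ^ 4) + ∑ _a : Fin 3, 32 * ∑ i, p i * ‖v i‖ ^ 6 :=
        add_le_add (Finset.sum_le_sum fun j _ => Finset.sum_le_sum fun k _ => cloudP2_sq_le hp hp1 j k)
          (Finset.sum_le_sum fun a _ => cloudP3_sq_le hp hp1 a)
    _ = 512 * ∑ i, p i * ‖v i‖ ^ 4 + 96 * ∑ i, p i * ‖v i‖ ^ 6 := by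
        simp only [Finset.sum_const, Finset.card_univ, Fintype.card_fin, nsmul_eq_mul]; push_cast; ring
    _ ≤ 512 * ∑ i, p i * (1 + ‖v i‖ ^ 6) + 96 * ∑ i, p i * (1 + ‖v i‖ ^ 6) := by nlinarith
    _ ≤ 1024 * ∑ i, p i * (1 + ‖v i‖ ^ 6) := by nlinarith

/-- The cloud defect is nonnegative. -/
theorem cloudDefect_nonneg (p : Fin n → ℝ) (v : Fin n → V3) : 0 ≤ cloudDefect p v :=
  add_nonneg (Finset.sum_nonneg fun _ _ => Finset.sum_nonneg fun _ _ => sq_nonneg _)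
    (Finset.sum_nonneg fun _ _ => sq_nonneg _)

end Envelope

end EEP

/-- Registered anchor of this helper file: the regularised cell law of the vocabulary is the regularised law of the
cell's velocity cloud with weights `ψ_N(x_i − x)/W_x` (`EEP.cellLaw_eq_cloudLaw`, definitions unfolded). -/
theorem bhEEPClosure_dictionary_anchor : ∀ (N : ℕ) (ψ : ℕ → T3 → ℝ) (h δ : ℝ) (w : Cfg N) (x : T3) (v : V3), cellLaw N ψ h δ w x v = (1 - δ) * (∑ i, cw N ψ w x i / cW N ψ w x * gauss h (w i).2 v) + δ * Literature.Analysis.FluidPDE.localMaxwellian 1 ((∑ i, cw N ψ w x i / cW N ψ w x * ‖(w i).2 - ∑ l, (cw N ψ w x l / cW N ψ w x) • (w l).2‖ ^ 2) / 3 + h ^ 2) (∑ l, (cw N ψ w x l / cW N ψ w x) • (w l).2) v :=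
  fun _ ψ h δ w x v => congrFun (EEP.cellLaw_eq_cloudLaw ψ w x h δ) v

end

end Summit.AtomisticToContinuum.HydrodynamicLimit.Theorems.BlockHDissipation
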